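import Summits.ResolutionOfSingularities.ResolutionOfSingularities.Theorems.WeightedInvariantLocalWeightedDropNCTameBinomialEndGame
import Summits.ResolutionOfSingularities.ResolutionOfSingularities.Theorems.WeightedInvariantLocalWeightedDropWildTerminalCalculus

/-!
# W4.3 `LocalWeightedDrop` — TOT rung R7: TAME RELATIVE BINOMIALS (the Jung rung) — PART 2: PHASE A (`relBinom` lift, `rounds`,
# `winsIn_relBinom`), the rung `TOTRungTameBinomial` / `totRungTameBinomial_of_toric`, the corollary `exists_winsIn_tameSuspension`
[OURS · L1 W4.3 · engine crux `LocalWeightedDrop` stmt-ResolutionOfSingularities-8899, line `nc-game-transport`; closes no stub by name.]  ADOPTION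
RECORD: lines 374–750 of res-L1-w43-strat-1's sketch `L/res-L1-w43-strat-1/tot_rung_r7_sketch.lean` (sha16 785e29c7255c4a72; evidence on 8899;
DELIVERED 2026-08-27T10:51:49Z), declaration texts BYTE-IDENTICAL, landed by the adoption hand res-D-pv-036 (res-L1-w43-plan-1 DEALS gen 10 #3 (3),
#4 (1)).  PART 1 (lines 1–372: orders, the statement (O) `OrderGrowth`, PHASE B end game, and the strategist's full module text) =
`…NCTameBinomialEndGame.lean` (res-D-pv-006); the split is forced by the lint «Theorems files with proofs ≤ 400 lines».  The CLOSER
`…NCTameBinomialRungClosed.lean` discharges `hstep`/`hend`/`hO` by `toricStep` (p523576), `toricEnd` (p521013), `order_slice_add_le_of_factor`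
(p524604).  ONE GATE-FORCED DEVIATION from the sketch: its `slice_X_zero'` restated the landed `WildTerminal.slice_X_zero`
(`…WildTerminalCalculus`, `dedup.landed`), so that copy is deleted and its five uses cite the landed lemma.  AI-produced, weaker than expert review; NOT a statement of the manuscript under review ([claim: Hironaka2017, status: under-review]).
-/
noncomputable section
open Literature.AlgebraicGeometry.Resolution
set_option linter.dupNamespace false -- mandated namespace of this single-conjunct summit
namespace Summit.ResolutionOfSingularities.ResolutionOfSingularities.Theorems
namespace NCTransport
open MvPowerSeries TameFourTupleDrop
variable {k : Type} [Field k]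
/-! ## PHASE A — playing the `x'`-strategy with `x_R` riding along (the relative lift) -/

section Lift

variable {m r M : ℕ} (hM : m + r + 1 = M)

/-- The TAME RELATIVE BINOMIAL `E · (M · x_R ^ d + h)` placed on the blocks: `E, M, h` on the left block `x_0, …, x_m`, the letter
`x_R` = the FIRST letter of the right block (of any size `r + 1`; the rung uses `r = 0`, idle letters are harmless). -/
def relBinom (d : ℕ) (E Mx h : MvPowerSeries (Fin (m + 1)) k) : MvPowerSeries (Fin (M + 1)) k :=
  rename (bL hM) E * (rename (bL hM) Mx * X (bR hM 0) ^ d + rename (bL hM) h)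

/-- An additive slice lemma (the slice is a ring map). -/
theorem slice_add' {n : ℕ} (i : Fin (n + 1)) (F G : MvPowerSeries (Fin (n + 1 + 1)) k) :
    TupleGame.slice i (F + G) = TupleGame.slice i F + TupleGame.slice i G := by
  unfold TupleGame.slice
  rw [← coe_substAlgHom (CobordantChartPlaneSlice.hasSubst_slice (R := k) i), map_add]

/-- The order of `x_s · f` is `1 + ord f`. -/
theorem order_X_mul {n : ℕ} (s : Fin n) (f : MvPowerSeries (Fin n) k) : (X s * f).order = 1 + f.order := by
  have h := order_X_pow_mul s 1 f
  rwa [pow_one, Nat.cast_one] at h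

/-- THE BLOCK EXTENSION OF A LEFT MOVE ACTS ON THE THREE LEFT DATA of a relative binomial and fixes `x_R`. -/
theorem subst_blockExtend_relBinom {Φ : Fin (m + 1) → MvPowerSeries (Fin (m + 1)) k} (hΦ0 : ∀ i, constantCoeff (Φ i) = 0)
    (d : ℕ) (E Mx h : MvPowerSeries (Fin (m + 1)) k) :
    subst (blockSubst hM Φ X) (relBinom hM d E Mx h) = relBinom hM d (subst Φ E) (subst Φ Mx) (subst Φ h) := by
  have hX0 : ∀ j : Fin (r + 1), constantCoeff (X j : MvPowerSeries (Fin (r + 1)) k) = 0 := fun j => constantCoeff_X j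
  have hΦs := hasSubst_blockSubst hM hΦ0 hX0
  have hxR : (X (bR hM 0) : MvPowerSeries (Fin (M + 1)) k) = rename (bR hM) (X 0) := by rw [rename_X]
  unfold relBinom
  rw [hxR, ← coe_substAlgHom hΦs]
  simp only [map_mul, map_add, map_pow]
  rw [coe_substAlgHom hΦs, subst_blockSubst_rename_bL hM hΦ0 hX0, subst_blockSubst_rename_bL hM hΦ0 hX0,
    subst_blockSubst_rename_bL hM hΦ0 hX0, subst_blockSubst_rename_bR hM hΦ0 hX0, subst_self]
  rfl

/-- THE TRANSFORM OF A RELATIVE BINOMIAL under (the chart of) a block-extended left move: the three left transforms, placed on the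
shifted left block, and `x_R ↦ y_R` (weight `0`, centre coordinate `0` on the right block). -/
theorem subst_chart_blockExtend_relBinom {Φ : Fin (m + 1) → MvPowerSeries (Fin (m + 1)) k} (hΦ0 : ∀ i, constantCoeff (Φ i) = 0)
    {w₁ : Fin (m + 1) → ℕ} {c : Fin (M + 1) → k} (hc : ∀ l, blockFun hM w₁ 0 l = 0 → c l = 0) (d : ℕ)
    (E Mx h : MvPowerSeries (Fin (m + 1)) k) :
    subst (CobordantChart.chart (blockFun hM w₁ 0) c) (subst (blockSubst hM Φ X) (relBinom hM d E Mx h)) =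
      rename (bL (succ_hM hM)) (subst (CobordantChart.chart w₁ fun i => c (bL hM i)) (subst Φ E)) *
        (rename (bL (succ_hM hM)) (subst (CobordantChart.chart w₁ fun i => c (bL hM i)) (subst Φ Mx)) *
            X (bR (succ_hM hM) 0) ^ d +
          rename (bL (succ_hM hM)) (subst (CobordantChart.chart w₁ fun i => c (bL hM i)) (subst Φ h))) := by
  have hch := CobordantChart.hasSubst_chart _ c hc
  have hwR : ∀ j, blockFun hM w₁ 0 (bR hM j) = 0 := fun j => by rw [blockFun_bR]; rfl
  have hxR : (X (bR hM 0) : MvPowerSeries (Fin (M + 1)) k) = rename (bR hM) (X 0) := by rw [rename_X]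
  rw [subst_blockExtend_relBinom hM hΦ0]
  unfold relBinom
  rw [hxR, ← coe_substAlgHom hch]
  simp only [map_mul, map_add, map_pow]
  rw [coe_substAlgHom hch, subst_chart_rename_bL hM hc (blockFun_bL hM w₁ 0) (fun i => rfl),
    subst_chart_rename_bL hM hc (blockFun_bL hM w₁ 0) (fun i => rfl), subst_chart_rename_bL hM hc (blockFun_bL hM w₁ 0) (fun i => rfl),
    subst_chart_rename_bR hM hc hwR, rename_X]

/-- KILLING `y_R`: the substitution `y_R ↦ 0` (all other chart variables fixed) shows that `s ∣ U · y_R ^ d + (left-block series)`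
with `d ≥ 1` forces `s ∣ (left-block series)`. -/
theorem X_dvd_rename_bL_of_X_dvd_add {U : MvPowerSeries (Fin (M + 1 + 1)) k} {H : MvPowerSeries (Fin (m + 1 + 1)) k} {d : ℕ}
    (hd : d ≠ 0) (h : X 0 ∣ U * X (bR (succ_hM hM) 0) ^ d + rename (bL (succ_hM hM)) H) :
    X 0 ∣ rename (bL (succ_hM hM)) H := by
  classical
  have h0ne : (0 : Fin (M + 1 + 1)) ≠ bR (succ_hM hM) 0 := fun h0 => by
    have := congrArg Fin.val h0
    simp only [bR_val, Fin.val_zero] at this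
    omega
  set κ : Fin (M + 1 + 1) → MvPowerSeries (Fin (M + 1 + 1)) k := fun l => if l = bR (succ_hM hM) 0 then 0 else X l with hκ
  have hκ0 : ∀ l, constantCoeff (κ l) = 0 := fun l => by
    simp only [hκ]
    split_ifs
    · exact map_zero _
    · exact constantCoeff_X _
  have hκs : HasSubst κ := hasSubst_of_constantCoeff_zero hκ0
  have hX : subst κ (X 0 : MvPowerSeries (Fin (M + 1 + 1)) k) = X 0 := by
    rw [subst_X hκs]
    simp only [hκ, if_neg h0ne]
  have hR : subst κ (X (bR (succ_hM hM) 0) : MvPowerSeries (Fin (M + 1 + 1)) k) = 0 := by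
    rw [subst_X hκs]
    simp only [hκ, if_pos rfl]
  have hL : subst κ (rename (bL (succ_hM hM)) H) = rename (bL (succ_hM hM)) H := by
    rw [subst_rename_eq _ hκs, rename_eq_subst]
    congr 1
    funext i
    simp only [Function.comp_apply, hκ, if_neg (bL_ne_bR (succ_hM hM) i 0)]
  have h2 := map_dvd (substAlgHom hκs) h
  rw [map_add, map_mul, map_pow, coe_substAlgHom hκs, hX, hR, zero_pow hd, mul_zero, zero_add, hL] at h2
  exact h2

/-- `s` DOES NOT DIVIDE THE LIFTED BRACKET `s^a · GM' · y_R^d + s^b · Gh'` (`min (a, b) = 0`, `d ≥ 1`, `s ∤ GM, Gh`). -/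
theorem not_X_dvd_liftBracket {GM Gh : MvPowerSeries (Fin (m + 1 + 1)) k} (hGM : ¬ X 0 ∣ GM) (hGh : ¬ X 0 ∣ Gh) {a b d : ℕ}
    (hab : a = 0 ∨ b = 0) (hd : d ≠ 0) :
    ¬ X 0 ∣ X 0 ^ a * rename (bL (succ_hM hM)) GM * X (bR (succ_hM hM) 0) ^ d + X 0 ^ b * rename (bL (succ_hM hM)) Gh := by
  intro hdvd
  have hprime := MvPowerSeries.prime_X' k (0 : Fin (M + 1 + 1))
  by_cases hb : b = 0
  · rw [hb, pow_zero, one_mul] at hdvd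
    exact hGh (X_dvd_of_X_dvd_rename_bL hM (X_dvd_rename_bL_of_X_dvd_add hM hd hdvd))
  · have ha : a = 0 := hab.resolve_right hb
    rw [ha, pow_zero, one_mul] at hdvd
    have h1 : X 0 ∣ rename (bL (succ_hM hM)) GM * X (bR (succ_hM hM) 0) ^ d :=
      (dvd_add_left (dvd_mul_of_dvd_left (dvd_pow_self (X 0) hb) _)).mp hdvd
    rcases hprime.dvd_or_dvd h1 with h2 | h2
    · exact hGM (X_dvd_of_X_dvd_rename_bL hM h2)
    · have h3 : X 0 ∣ rename (bR (succ_hM hM)) (X 0 : MvPowerSeries (Fin (r + 1)) k) := by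
        rw [rename_X]; exact hprime.dvd_of_dvd_pow h2
      exact (MvPowerSeries.prime_X' k (0 : Fin (r + 1))).ne_zero (eq_zero_of_X_dvd_rename_bR hM h3)

/-- THE NEW POSITION AT A LIVE LEFT SLOT is again a tame relative binomial: `s · (lifted transform)|_{y_{i₁} = 0}` equals
`relBinom d (s · GE|) ((s^a GM)|) ((s^b Gh)|)`. -/
theorem X_mul_slice_liftTransform {GE GM Gh : MvPowerSeries (Fin (m + 1 + 1)) k} (i₁ : Fin (m + 1)) (a b d : ℕ) :
    X 0 * TupleGame.slice (bL hM i₁)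
        (rename (bL (succ_hM hM)) GE *
          (X 0 ^ a * rename (bL (succ_hM hM)) GM * X (bR (succ_hM hM) 0) ^ d + X 0 ^ b * rename (bL (succ_hM hM)) Gh)) =
      relBinom hM d (X 0 * TupleGame.slice i₁ GE) (TupleGame.slice i₁ (X 0 ^ a * GM)) (TupleGame.slice i₁ (X 0 ^ b * Gh)) := by
  have hxR : (X (bR (succ_hM hM) 0) : MvPowerSeries (Fin (M + 1 + 1)) k) = rename (bR (succ_hM hM)) (X 0) := by rw [rename_X]
  have h1 : X 0 ^ a * rename (bL (succ_hM hM)) GM = rename (bL (succ_hM hM)) (X 0 ^ a * GM) := by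
    rw [map_mul, map_pow, rename_bL_X_zero hM]
  have h2 : X 0 ^ b * rename (bL (succ_hM hM)) Gh = rename (bL (succ_hM hM)) (X 0 ^ b * Gh) := by
    rw [map_mul, map_pow, rename_bL_X_zero hM]
  rw [h1, h2, hxR, slice_mul, slice_add', slice_mul, slice_pow, slice_bL_rename_bL hM, slice_bL_rename_bL hM,
    slice_bL_rename_bL hM, slice_bL_rename_bR hM, rename_X]
  unfold relBinom
  rw [map_mul, rename_X, bL_zero, mul_assoc]

/-- THE ROUND BUDGET of the relative strategy: `rounds M d n K` rounds suffice from a relative binomial whose `x'`-product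
`E · M · h` is won within `n` rounds and whose POTENTIAL `ord E + ord M + ord h` is at most `K` (the potential at most doubles
(`+1`) per round by (O); at the end the exponents of the binomial lie in the box `[0, K + d]`). -/
def rounds (M d : ℕ) : ℕ → ℕ → ℕ
  | 0, K => boxBudget M (K + d)
  | n + 1, K => max (rounds M d n K) (rounds M d n (2 * K + 1) + 1)

/-- **THE RELATIVE STRATEGY** (Phase A by induction on the `x'`-rounds, Phase B at the end). -/
theorem winsIn_relBinom (hstep : ToricStep M) (hend : ToricEnd M) (hO : OrderGrowth (m + 1)) {d : ℕ} (hd : (d : k) ≠ 0) :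
    ∀ (n K : ℕ) (E Mx h : MvPowerSeries (Fin (m + 1)) k), E ≠ 0 → Mx ≠ 0 → h ≠ 0 →
      (∃ oE oM oh : ℕ, E.order = oE ∧ Mx.order = oM ∧ h.order = oh ∧ oE + oM + oh ≤ K) →
      WinsIn GermIsNC n (E * Mx * h) → WinsIn (m := M) GermIsNC (rounds M d n K) (relBinom hM d E Mx h) := by
  classical
  have hd0 : d ≠ 0 := by
    rintro rfl
    exact hd Nat.cast_zero
  intro n
  induction n with
  | zero =>
    intro K E Mx h hE hMx hh hpot hwin
    obtain ⟨oE, oM, oh, hoE, hoM, hoh, hK⟩ := hpot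
    obtain ⟨Φ, u, γ, hΦ0, hdet, hu, hprod⟩ := hwin
    have hΦs : HasSubst Φ := hasSubst_of_constantCoeff_zero hΦ0
    have hdet' : IsUnit (FormalCoordChange.linMat Φ).det := hdet
    have hsubst3 : subst Φ (E * Mx * h) = subst Φ E * subst Φ Mx * subst Φ h := by
      rw [← coe_substAlgHom hΦs, map_mul, map_mul]
    rw [hsubst3] at hprod
    obtain ⟨vE, ε, hvE, hEeq⟩ := TrackC.exists_eq_unit_mul_monomial_of_dvd u hu γ (subst Φ E)
      ⟨subst Φ Mx * subst Φ h, by rw [← hprod, mul_assoc]⟩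
    obtain ⟨vM, μ, hvM, hMeq⟩ := TrackC.exists_eq_unit_mul_monomial_of_dvd u hu γ (subst Φ Mx)
      ⟨subst Φ E * subst Φ h, by rw [← hprod]; ring⟩
    obtain ⟨vh, e, hvh, hheq⟩ := TrackC.exists_eq_unit_mul_monomial_of_dvd u hu γ (subst Φ h)
      ⟨subst Φ E * subst Φ Mx, by rw [← hprod]; ring⟩
    -- the exponent sums are the orders
    have hsum : ∀ {F : MvPowerSeries (Fin (m + 1)) k} {v : MvPowerSeries (Fin (m + 1)) k} {e₀ : Fin (m + 1) → ℕ} {o : ℕ},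
        constantCoeff v ≠ 0 → subst Φ F = v * ∏ i, X i ^ e₀ i → F.order = o → (∑ i, e₀ i) = o := by
      intro F v e₀ o hv hFeq ho
      have h1 := order_unit_mul_prod_X_pow hv e₀
      rw [← hFeq, order_subst_of_isUnit_det hΦ0 hdet', ho] at h1
      exact_mod_cast h1.symm
    have hsE := hsum hvE hEeq hoE
    have hsM := hsum hvM hMeq hoM
    have hsh := hsum hvh hheq hoh
    -- the transported position is a binomial with unit coefficients
    set α : Fin (M + 1) →₀ ℕ := Finsupp.equivFunOnFinite.symm (blockFun hM (fun i => ε i + μ i) (fun j => if j = 0 then d else 0))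
      with hα
    set β : Fin (M + 1) →₀ ℕ := Finsupp.equivFunOnFinite.symm (blockFun hM (fun i => ε i + e i) (fun _ => 0)) with hβ
    have hRd : (∏ j : Fin (r + 1), (X (bR hM j) : MvPowerSeries (Fin (M + 1)) k) ^ (if j = 0 then d else 0)) = X (bR hM 0) ^ d := by
      rw [Fintype.prod_eq_single (0 : Fin (r + 1)) (fun j hj => by rw [if_neg hj, pow_zero]), if_pos rfl]
    have hαp : (monomial α (1 : k) : MvPowerSeries (Fin (M + 1)) k) =
        (∏ i, X (bL hM i) ^ ε i) * (∏ i, X (bL hM i) ^ μ i) * X (bR hM 0) ^ d := by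
      rw [hα, ← MonomialWon.prod_X_pow_eq_monomial, prod_block hM, ← hRd]
      simp only [blockFun_bL, blockFun_bR, pow_add, Finset.prod_mul_distrib]
    have hβp : (monomial β (1 : k) : MvPowerSeries (Fin (M + 1)) k) = (∏ i, X (bL hM i) ^ ε i) * ∏ i, X (bL hM i) ^ e i := by
      rw [hβ, ← MonomialWon.prod_X_pow_eq_monomial, prod_block hM]
      simp only [blockFun_bL, blockFun_bR, pow_add, Finset.prod_mul_distrib, pow_zero, Finset.prod_const_one, mul_one]
    have hQ : subst (blockSubst hM Φ X) (relBinom hM d E Mx h) =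
        (rename (bL hM) vE * rename (bL hM) vM) * monomial α 1 + (rename (bL hM) vE * rename (bL hM) vh) * monomial β 1 := by
      rw [subst_blockExtend_relBinom hM hΦ0, hEeq, hMeq, hheq, hαp, hβp]
      unfold relBinom
      rw [map_mul, map_mul, map_mul, map_prod, map_prod, map_prod]
      simp only [map_pow, rename_X]
      ring
    have hv₁ : constantCoeff (rename (bL hM) vE * rename (bL hM) vM) ≠ 0 := by
      rw [map_mul, constantCoeff_rename, constantCoeff_rename]; exact mul_ne_zero hvE hvM
    have hv₂ : constantCoeff (rename (bL hM) vE * rename (bL hM) vh) ≠ 0 := by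
      rw [map_mul, constantCoeff_rename, constantCoeff_rename]; exact mul_ne_zero hvE hvh
    have hsep : ∃ t, ((α t : ℕ) : k) ≠ ((β t : ℕ) : k) := ⟨bR hM 0, by
      rw [hα, hβ, Finsupp.coe_equivFunOnFinite_symm, Finsupp.coe_equivFunOnFinite_symm, blockFun_bR, blockFun_bR, if_pos rfl,
        Nat.cast_zero]
      exact hd⟩
    have hbox : ∀ t, α t ≤ K + d ∧ β t ≤ K + d := by
      intro t
      rw [hα, hβ, Finsupp.coe_equivFunOnFinite_symm, Finsupp.coe_equivFunOnFinite_symm]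
      rcases block_cases hM t with ⟨i, rfl⟩ | ⟨j, rfl⟩
      · rw [blockFun_bL, blockFun_bL]
        have h1 : ε i ≤ ∑ i, ε i := Finset.single_le_sum (fun _ _ => Nat.zero_le _) (Finset.mem_univ i)
        have h2 : μ i ≤ ∑ i, μ i := Finset.single_le_sum (fun _ _ => Nat.zero_le _) (Finset.mem_univ i)
        have h3 : e i ≤ ∑ i, e i := Finset.single_le_sum (fun _ _ => Nat.zero_le _) (Finset.mem_univ i)
        constructor <;> omega
      · rw [blockFun_bR, blockFun_bR]
        constructor
        · split_ifs <;> omega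
        · omega
    have hwinQ := winsIn_binomial hstep hend hv₁ hv₂ hsep hbox
    rw [← hQ] at hwinQ
    exact winsIn_germIsNC_of_subst (constantCoeff_blockSubst hM hΦ0 fun j => constantCoeff_X j)
      (by rw [det_linMat_blockSubst]; exact hdet.mul (isUnit_det_linMat_perm (Equiv.refl _))) _ _ hwinQ
  | succ n ih =>
    intro K E Mx h hE hMx hh hpot hwin
    rw [show rounds M d (n + 1) K = max (rounds M d n K) (rounds M d n (2 * K + 1) + 1) from rfl]
    rcases hwin with hwin | ⟨Φ₁, w₁, hmv, hcl⟩
    · exact WinsIn.mono (le_max_left _ _) (ih K E Mx h hE hMx hh hpot hwin)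
    refine WinsIn.mono (le_max_right _ _) (winsIn_move (isCountMove_blockExtend hM hmv) fun c hc hc0 A G hfac hG => ?_)
    obtain ⟨hΦ0, hdet, hw1, -⟩ := hmv
    obtain ⟨oE, oM, oh, hoE, hoM, hoh, hK⟩ := hpot
    have hprime0 := MvPowerSeries.prime_X' k (0 : Fin (m + 1))
    have hprime := MvPowerSeries.prime_X' k (0 : Fin (m + 1 + 1))
    have hPrime := MvPowerSeries.prime_X' k (0 : Fin (M + 1 + 1))
    -- the exceptional point restricted to the left block
    have hcR : ∀ j, c (bR hM j) = 0 := fun j => hc _ (by rw [blockFun_bR]; rfl)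
    have hc₁ : ∀ i, w₁ i = 0 → c (bL hM i) = 0 := fun i hi => hc _ (by rw [blockFun_bL]; exact hi)
    have hc₁0 : (fun i => c (bL hM i)) ≠ 0 := by
      intro h0
      apply hc0
      funext l
      rcases block_cases hM l with ⟨i, rfl⟩ | ⟨j, rfl⟩
      · exact congr_fun h0 i
      · exact hcR j
    -- the three left transforms and their `s`-saturations
    have hne : ∀ {F : MvPowerSeries (Fin (m + 1)) k}, F ≠ 0 →
        subst (CobordantChart.chart w₁ fun i => c (bL hM i)) (subst Φ₁ F) ≠ 0 := fun hF =>
      CobordantChart.subst_chart_ne_zero w₁ _ hc₁ (FormalCoordChange.subst_ne_zero_of_isUnit_det hΦ0 hdet hF)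
    obtain ⟨aE, GE, hfacE, hGE⟩ := CobordantVertexChart.exists_eq_X_pow_mul_not_dvd (hne hE)
    obtain ⟨aM, GM, hfacM, hGM⟩ := CobordantVertexChart.exists_eq_X_pow_mul_not_dvd (hne hMx)
    obtain ⟨ah, Gh, hfach, hGh⟩ := CobordantVertexChart.exists_eq_X_pow_mul_not_dvd (hne hh)
    -- `μ0 := min (aM, ah)` is absorbed into the `s`-power; `a, b` are the residual exponents (`min (a, b) = 0`)
    obtain ⟨μ0, a, b, haM, hah, hab⟩ : ∃ μ0 a b : ℕ, aM = μ0 + a ∧ ah = μ0 + b ∧ (a = 0 ∨ b = 0) := by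
      rcases le_total aM ah with h1 | h1
      · exact ⟨aM, 0, ah - aM, by omega, by omega, Or.inl rfl⟩
      · exact ⟨ah, aM - ah, 0, by omega, by omega, Or.inr rfl⟩
    subst haM hah
    -- the `x'`-product transform
    have hch₁ := CobordantChart.hasSubst_chart w₁ (fun i => c (bL hM i)) hc₁
    have hΦ₁s : HasSubst Φ₁ := hasSubst_of_constantCoeff_zero hΦ0
    have hfac₁ : subst (CobordantChart.chart w₁ fun i => c (bL hM i)) (subst Φ₁ (E * Mx * h)) =
        X 0 ^ (aE + (μ0 + a) + (μ0 + b)) * (GE * GM * Gh) := by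
      rw [← coe_substAlgHom hΦ₁s, map_mul, map_mul, coe_substAlgHom hΦ₁s, ← coe_substAlgHom hch₁, map_mul, map_mul,
        coe_substAlgHom hch₁, hfacE, hfacM, hfach]
      ring
    have hG₁ : ¬ X 0 ∣ GE * GM * Gh := fun h' =>
      (hprime.dvd_or_dvd h').elim (fun h'' => (hprime.dvd_or_dvd h'').elim hGE hGM) hGh
    -- the transform of the relative binomial: `s^(aE + μ0) · Gbig`
    have hprod : subst (CobordantChart.chart (blockFun hM w₁ 0) c) (subst (blockSubst hM Φ₁ X) (relBinom hM d E Mx h)) =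
        X 0 ^ (aE + μ0) * (rename (bL (succ_hM hM)) GE *
          (X 0 ^ a * rename (bL (succ_hM hM)) GM * X (bR (succ_hM hM) 0) ^ d + X 0 ^ b * rename (bL (succ_hM hM)) Gh)) := by
      rw [subst_chart_blockExtend_relBinom hM hΦ0 hc, hfacE, hfacM, hfach, map_mul, map_mul, map_mul, map_pow, map_pow, map_pow,
        rename_bL_X_zero hM]
      ring
    have hGbig : ¬ X 0 ∣ rename (bL (succ_hM hM)) GE *
        (X 0 ^ a * rename (bL (succ_hM hM)) GM * X (bR (succ_hM hM) 0) ^ d + X 0 ^ b * rename (bL (succ_hM hM)) Gh) := fun h' =>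
      (hPrime.dvd_or_dvd h').elim (fun h1 => hGE (X_dvd_of_X_dvd_rename_bL hM h1)) (not_X_dvd_liftBracket hM hGM hGh hab hd0)
    have hsat : (1 : MvPowerSeries (Fin (M + 1 + 1)) k) * (X 0 ^ (aE + μ0) * (rename (bL (succ_hM hM)) GE *
        (X 0 ^ a * rename (bL (succ_hM hM)) GM * X (bR (succ_hM hM) 0) ^ d + X 0 ^ b * rename (bL (succ_hM hM)) Gh))) =
        X 0 ^ A * G := by rw [one_mul, ← hprod, hfac]
    obtain ⟨-, hGeq⟩ := saturation_unit_mul (by rw [map_one]; exact one_ne_zero) hGbig hG hsat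
    -- the `x'`-clause picks the live (left) slot
    obtain ⟨i₁, hci₁, hwin₁⟩ := hcl (fun i => c (bL hM i)) hc₁ hc₁0 _ _ hfac₁ hG₁
    refine ⟨bL hM i₁, hci₁, ?_⟩
    rw [hGeq, one_mul, X_mul_slice_liftTransform hM i₁ a b d]
    -- the successors are non-zero
    have hsE0 := TupleDropAssembly.slice_ne_zero (subst Φ₁ E) w₁ _ hc₁ hw1 aE GE hfacE hGE i₁ hci₁
    have hsM0 := TupleDropAssembly.slice_ne_zero (subst Φ₁ Mx) w₁ _ hc₁ hw1 _ GM hfacM hGM i₁ hci₁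
    have hsh0 := TupleDropAssembly.slice_ne_zero (subst Φ₁ h) w₁ _ hc₁ hw1 _ Gh hfach hGh i₁ hci₁
    have hE' : X 0 * TupleGame.slice i₁ GE ≠ 0 := mul_ne_zero hprime0.ne_zero hsE0
    have hM' : TupleGame.slice i₁ (X 0 ^ a * GM) ≠ 0 := by
      rw [slice_mul, slice_pow, WildTerminal.slice_X_zero]; exact mul_ne_zero (pow_ne_zero _ hprime0.ne_zero) hsM0
    have hh' : TupleGame.slice i₁ (X 0 ^ b * Gh) ≠ 0 := by
      rw [slice_mul, slice_pow, WildTerminal.slice_X_zero]; exact mul_ne_zero (pow_ne_zero _ hprime0.ne_zero) hsh0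
    -- the potential at the successors: (O) three times
    have hordΦ : ∀ {F : MvPowerSeries (Fin (m + 1)) k} {o : ℕ}, F.order = o → (subst Φ₁ F).order = o := fun ho => by
      rw [order_subst_of_isUnit_det hΦ0 hdet, ho]
    obtain ⟨oE', hoE', hbE⟩ := hO k (subst Φ₁ E) w₁ _ (FormalCoordChange.subst_ne_zero_of_isUnit_det hΦ0 hdet hE) hc₁ hw1
      aE GE hfacE hGE i₁ hci₁ oE (hordΦ hoE)
    obtain ⟨oM', hoM', hbM⟩ := hO k (subst Φ₁ Mx) w₁ _ (FormalCoordChange.subst_ne_zero_of_isUnit_det hΦ0 hdet hMx) hc₁ hw1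
      _ GM hfacM hGM i₁ hci₁ oM (hordΦ hoM)
    obtain ⟨oh', hoh', hbh⟩ := hO k (subst Φ₁ h) w₁ _ (FormalCoordChange.subst_ne_zero_of_isUnit_det hΦ0 hdet hh) hc₁ hw1
      _ Gh hfach hGh i₁ hci₁ oh (hordΦ hoh)
    have hpot' : ∃ oE₁ oM₁ oh₁ : ℕ, (X 0 * TupleGame.slice i₁ GE).order = (oE₁ : ℕ∞) ∧
        (TupleGame.slice i₁ (X 0 ^ a * GM)).order = (oM₁ : ℕ∞) ∧ (TupleGame.slice i₁ (X 0 ^ b * Gh)).order = (oh₁ : ℕ∞) ∧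
        oE₁ + oM₁ + oh₁ ≤ 2 * K + 1 := by
      refine ⟨1 + oE', a + oM', b + oh', ?_, ?_, ?_, by omega⟩
      · rw [order_X_mul, hoE', Nat.cast_add, Nat.cast_one]
      · rw [slice_mul, slice_pow, WildTerminal.slice_X_zero, order_X_pow_mul, hoM', Nat.cast_add]
      · rw [slice_mul, slice_pow, WildTerminal.slice_X_zero, order_X_pow_mul, hoh', Nat.cast_add]
    -- the `x'`-product of the successors is won within `n` rounds (it divides a power of the `x'`-clause's position)
    have hne₁ : X 0 * TupleGame.slice i₁ (GE * GM * Gh) ≠ 0 :=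
      mul_ne_zero hprime0.ne_zero (TupleDropAssembly.slice_ne_zero (subst Φ₁ (E * Mx * h)) w₁ _ hc₁ hw1 _ _ hfac₁ hG₁ i₁ hci₁)
    have hdvd : X 0 * TupleGame.slice i₁ GE * TupleGame.slice i₁ (X 0 ^ a * GM) * TupleGame.slice i₁ (X 0 ^ b * Gh) ∣
        (X 0 * TupleGame.slice i₁ (GE * GM * Gh)) ^ (a + b + 1) := by
      rw [slice_mul, slice_mul, slice_mul, slice_mul, slice_pow, slice_pow, WildTerminal.slice_X_zero]
      exact ⟨(TupleGame.slice i₁ GE * TupleGame.slice i₁ GM * TupleGame.slice i₁ Gh) ^ (a + b), by ring⟩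
    have hwin' : WinsIn GermIsNC n
        (X 0 * TupleGame.slice i₁ GE * TupleGame.slice i₁ (X 0 ^ a * GM) * TupleGame.slice i₁ (X 0 ^ b * Gh)) :=
      winsIn_of_dvd_pow_at (a + b) (fun b' d' hd' hnc hdvd' => germIsNC_of_dvd_pow (a + b) b' d' hd' hnc hdvd') n _ _ hne₁ hwin₁ hdvd
    exact ih (2 * K + 1) _ _ _ hE' hM' hh' hpot' hwin'

/-- The relative strategy from an arbitrary winnable `x'`-product: finitely many rounds suffice. -/
theorem exists_winsIn_relBinom (hstep : ToricStep M) (hend : ToricEnd M) (hO : OrderGrowth (m + 1)) {d : ℕ} (hd : (d : k) ≠ 0)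
    {E Mx h : MvPowerSeries (Fin (m + 1)) k} (hE : E ≠ 0) (hMx : Mx ≠ 0) (hh : h ≠ 0)
    (hwin : ∃ n, WinsIn (m := m) GermIsNC n (E * Mx * h)) : ∃ n, WinsIn (m := M) GermIsNC n (relBinom hM d E Mx h) := by
  obtain ⟨n, hn⟩ := hwin
  have hfin : ∀ f : MvPowerSeries (Fin (m + 1)) k, f ≠ 0 → ∃ o : ℕ, f.order = o := fun f hf =>
    ⟨f.order.toNat, (ne_zero_iff_order_finite.mp hf).symm⟩
  obtain ⟨oE, hoE⟩ := hfin E hE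
  obtain ⟨oM, hoM⟩ := hfin Mx hMx
  obtain ⟨oh, hoh⟩ := hfin h hh
  exact ⟨_, winsIn_relBinom hM hstep hend hO hd n (oE + oM + oh) E Mx h hE hMx hh ⟨oE, oM, oh, hoE, hoM, hoh, le_rfl⟩ hn⟩

end Lift

/-! ## THE RUNG -/

/-- **TOT RUNG R7 — TAME RELATIVE BINOMIALS** (statement; OURS · L1 W4.3, line `nc-game-transport`; census spelling): over an
algebraically closed field of characteristic `p`, for `p ∤ d` and non-zero `E, M, h ∈ k⟦x_0, …, x_m⟧` whose product `E · M · h` the mover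
wins (forces normal-crossing support) within finitely many rounds of the count game in `m + 1` variables, the mover wins the relative
binomial `E · (M · x_{m+1} ^ d + h)` within finitely many rounds of the count game in `m + 2` variables. -/
def TOTRungTameBinomial (m : ℕ) : Prop :=
  ∀ (p : ℕ), p.Prime → ∀ (k : Type) [Field k] [CharP k p] [IsAlgClosed k], ∀ (d : ℕ), ¬ p ∣ d →
    ∀ E Mx h : MvPowerSeries (Fin (m + 1)) k, E ≠ 0 → Mx ≠ 0 → h ≠ 0 →
      (∃ n, WinsIn (m := m) GermIsNC n (E * Mx * h)) →
      ∃ n, WinsIn (m := m + 1) GermIsNC n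
        (MvPowerSeries.subst (fun i : Fin (m + 1) => (X ⟨i.val, by omega⟩ : MvPowerSeries (Fin (m + 1 + 1)) k)) E *
          (MvPowerSeries.subst (fun i : Fin (m + 1) => (X ⟨i.val, by omega⟩ : MvPowerSeries (Fin (m + 1 + 1)) k)) Mx *
              X ⟨m + 1, by omega⟩ ^ d +
            MvPowerSeries.subst (fun i : Fin (m + 1) => (X ⟨i.val, by omega⟩ : MvPowerSeries (Fin (m + 1 + 1)) k)) h))

/-- **TOT RUNG R7 FROM THE TORIC GAME AND (O)**: `ToricStep (m + 1)`, `ToricEnd (m + 1)` (rung R6's two lemmas, one dimension up)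
and the order-growth lemma `OrderGrowth (m + 1)` give the tame relative-binomial rung in `m + 2` variables — in every
characteristic (only `(d : k) ≠ 0` is used). -/
theorem totRungTameBinomial_of_toric (m : ℕ) (hstep : ToricStep (m + 1)) (hend : ToricEnd (m + 1)) (hO : OrderGrowth (m + 1)) :
    TOTRungTameBinomial m := by
  intro p hp k _ _ _ d hpd E Mx h hE hMx hh hwin
  have hd : (d : k) ≠ 0 := fun h0 => hpd ((CharP.cast_eq_zero_iff k p d).mp h0)
  have hmain := exists_winsIn_relBinom (m := m) (r := 0) (M := m + 1) rfl hstep hend hO hd hE hMx hh hwin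
  unfold relBinom at hmain
  rw [rename_eq_subst, rename_eq_subst, rename_eq_subst] at hmain
  exact hmain


/-! ## COROLLARY — the tame suspension of a plane curve ((K-c) of the `N = 4` tame census = R7 at `m = 1`, `E = M = 1`) -/

/-- **(K-c) FROM R7**: for a non-zero plane germ `c(x_0, x_1)` and `(d : k) ≠ 0`, the mover wins the TAME SUSPENSION
`x_2 ^ d + c(x_0, x_1)` within finitely many rounds of the count game in three variables — given the toric game one dimension up
(`ToricStep 2`, `ToricEnd 2`) and (O) in two variables. The `x'`-win is the plane theorem `winsIn_plane`. -/
theorem exists_winsIn_tameSuspension (hstep : ToricStep 2) (hend : ToricEnd 2) (hO : OrderGrowth 2) {d : ℕ} (hd : (d : k) ≠ 0)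
    (c : MvPowerSeries (Fin 2) k) (hc : c ≠ 0) :
    ∃ n, WinsIn (m := 2) GermIsNC n (X 2 ^ d + rename Fin.castSucc c) := by
  obtain ⟨n, hn⟩ := winsIn_plane k c hc
  have h := exists_winsIn_relBinom (m := 1) (r := 0) (M := 2) rfl hstep hend hO hd (E := 1) (Mx := 1) (h := c)
    one_ne_zero one_ne_zero hc ⟨n, by rwa [one_mul, one_mul]⟩
  have heq : relBinom (m := 1) (r := 0) (M := 2) rfl d 1 1 c = X 2 ^ d + rename Fin.castSucc c := by
    unfold relBinom
    simp only [map_one, one_mul]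
    rfl
  rwa [heq] at h
end NCTransport
end Summit.ResolutionOfSingularities.ResolutionOfSingularities.Theorems
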